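import Summits.HodgeConjecture.HodgeConjecture.Theorems.HLiu418E2ArchOrthHolPrep
import Literature.NumberTheory.Automorphic.UnitaryGroupArchFactor
import Literature.NumberTheory.Automorphic.UnitaryCurveCohCotangentFormsContinuous
import Mathlib.Analysis.InnerProductSpace.ProdL2
import HarnessLib

/-!
# Crux `HLiu418`, K-lane E1′₂ by the RANK-2 COLLAPSE — FILE D, part 1 (generic lemmas): `K_c` idle on holomorphic cotangent classes, the
# three-factor matrix coefficient under the disc identity with value, non-vanishing of classes, and SCHUR SCALING of two Gram forms through `L² ⊕₂ L²`

Cell hodgecm-mathlib (D-0151), FLOOR 0, programme P5 (Alb-CM), crux item `HLiu418` = stmt-HodgeConjecture-24832; K-lane E1′₂, road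
«`Rogawski1990.curveCohFinComponentUnique_hol` ⇐ `Rogawski1990.curveMultiplicityLeOne` ALONE» (pen F0P5-p02 (g3), cut `CENSUS-KE1prime-collapse.v0`
ac70c5fe, DEAL v1.2 2026-08-31T03:31Z: D = A-p04 (g21), piece S absorbed).  THEOREMS ONLY; `--supports stmt-HodgeConjecture-24832 --as helper`.
HC_CM is proved only modulo the 7 printed citations until rung 0 closes; this file proves nothing about them.  Consumer: `Theorems/HLiu418E1pOfE1`
(the core `eq_of_discIdentity_of_holRealised` and the heads).

Generic rank-2 unitary datum `U(J)` (`F ⊂ E`, `c`, complex place `w₁`, cone frame `𝔣`), automorphic `μ`, compact quotient where classes of forms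
are taken.
* `toLp_eq_of_mem_Kc` — `R(k)[f] = [f]` for `f ∈ holCotForms₂ 𝔣`, `k ∈ K_c` (clause (Kc) of ★ `mem_holCotForms₂_iff` + ★ `rightRegular_toLp_eq`);
* `inner_rightRegular_clsMap` — for the class map `Λ` of an equivariant hol-valued `ψ` and a scalar `m` with the disc identity with value:
  `⟪R(sec u · k · (1,g)) Λ w, Λ w′⟫ = m(u) · ⟪Λ(σ g w), Λ w′⟫`;
* `clsMap_ne_zero` — `ψ ≠ 0` equivariant out of an irreducible `σ` ⇒ `Λ w ≠ 0` for `w ≠ 0` (★ `toLp_toQuotFun_ne_zero`);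
* `gram_eq_mul_gram` — for `σ` irreducible admissible and two equivariant `Λ, Λ′ : W → L²`: `‖Λ w₀‖² · ⟪Λ′ w, Λ′ w′⟫ = ‖Λ′ w₀‖² · ⟪Λ w, Λ w′⟫`
  (Schur ★ `F0P2aStubS1SesqSchur.stubS1_holds` on `V := L² ⊕₂ L²`, `φ₁ = (Λ,Λ′)`, `φ₂ = (0,Λ′)` — the product trick, since the cross form
  `⟪Λ w, Λ′ w′⟫` may vanish, e.g. when `P ⊥ P′`).
[Bump1997, Prop. 4.2.4]; [BorelJacquet1979, §4.1, §4.6]; [Liu2021, App. D, proof of Prop. D.4].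

## References
* [Bump1997] D. Bump, *Automorphic Forms and Representations* (1997), Prop. 4.2.4.
* [BorelJacquet1979] A. Borel, H. Jacquet, Corvallis PSPM 33.1 (1979), §4.1, §4.6.  [BernsteinZelevinsky1976] §2.1.
* [Liu2021] Y. Liu (2021), App. D, proof of Prop. D.4 (p. 130–131).
-/

set_option autoImplicit false
-- the mandated namespace has the single-problem summit's repeated segment (`HodgeConjecture.HodgeConjecture`)
set_option linter.dupNamespace false

noncomputable section

open MeasureTheory NumberField NumberField.InfinitePlace
open scoped Matrix ComplexConjugate ComplexOrder InnerProductSpace ENNReal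
open Literature.NumberTheory.Automorphic Literature.NumberTheory.Automorphic.UnitaryGroup
open Literature.NumberTheory.Automorphic.UnitaryGroup.CotangentForms (toQuotFun toQuotFun_mk)
open Literature.NumberTheory.Automorphic.UnitaryCurveForms
open Summit.HodgeConjecture.HodgeConjecture.Cruxes.H413.SpectrumJunction
open Summit.HodgeConjecture.HodgeConjecture.Cruxes.HLiu418.E2Density
open Summit.HodgeConjecture.HodgeConjecture.Cruxes.HLiu418.E2Bootstrap
open Summit.HodgeConjecture.HodgeConjecture.Cruxes.HLiu418.E2ArchOrthHolPrep
open Summit.HodgeConjecture.HodgeConjecture.Cruxes.H413 (F0P2aStubS1SesqSchur.stubS1_holds)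

namespace Summit.HodgeConjecture.HodgeConjecture.Cruxes.HLiu418.E1pGram

variable {F E : Type} [Field F] [NumberField F] [Field E] [NumberField E] [Algebra F E]
  {c : E ≃ₐ[F] E} {J : Matrix (Fin 2) (Fin 2) E}
  {hc : c ≠ 1} {hfix : ∀ w : InfinitePlace E, c • w = w} {w₁ : {w : InfinitePlace E // IsComplex w}} {𝔣 : ConeFrame E J w₁}
  {μ : Measure (adelicGroupData F E c 2 J).automorphicQuotient} [(adelicGroupData F E c 2 J).IsAutomorphicMeasure μ]
  [CompactSpace (adelicGroupData F E c 2 J).automorphicQuotient]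

/-! ## §1 The class of a cone-holomorphic cotangent form: `K_c` idle, the three-factor matrix coefficient, non-vanishing -/

/-- **`K_c` IS IDLE ON HOLOMORPHIC COTANGENT CLASSES**: for `f ∈ holCotForms₂ 𝔣` and `k` in the archimedean factor away from `w₁`, `R(k)[f] = [f]`
(clause (Kc) of ★ `mem_holCotForms₂_iff` read on classes through ★ `rightRegular_toLp_eq`). [cite: BorelJacquet1979, §4.6] -/
theorem toLp_eq_of_mem_Kc {f : (adelicGroupData F E c 2 J).Adelic → ℂ} (hf : f ∈ holCotForms₂ F E c J hc hfix w₁ 𝔣)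
    (hfm : MemLp (toQuotFun (adelicGroupData F E c 2 J) f) 2 μ) {k : (adelicGroupData F E c 2 J).Adelic}
    (hk : k ∈ ((archAt F E c 2 J w₁ (hfix w₁.1) hc).ker).map (archToAdelic F E c 2 J)) :
    (adelicGroupData F E c 2 J).rightRegular μ k (hfm.toLp (toQuotFun (adelicGroupData F E c 2 J) f)) =
      hfm.toLp (toQuotFun (adelicGroupData F E c 2 J) f) := by
  rw [rightRegular_toLp_eq hf hfm k]
  have hfk : (fun x => f (x * k)) = f := funext fun x => ((mem_holCotForms₂_iff F E c J hc hfix w₁ 𝔣 f).1 hf).2.1 k hk x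
  exact MemLp.toLp_congr _ _ (Filter.EventuallyEq.of_eq (by rw [hfk]))

/-- **THE THREE-FACTOR MATRIX COEFFICIENT.**  Let `σ` act on `W`, `ψ : W → (U(J)(𝔸_F) → ℂ)` be `rightRep₂`-equivariant with cone-holomorphic
values and `Λ` its class map (`Λ w = [ψ w]`, `R(1,g) Λ w = Λ (σ g w)`), and let `m` satisfy the disc identity with value on hol-cotangent classes.
Then for `x = sec(u) · k · (1, g)` (`k ∈ K_c`): `⟪R(x) Λ w, Λ w′⟫ = m(u) · ⟪Λ (σ g w), Λ w′⟫`. [cite: BorelJacquet1979, §4.1 and §4.6]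
[cite: Liu2021, App. D, proof of Prop. D.4] -/
theorem inner_rightRegular_clsMap (m : archLocal E 2 J w₁ → ℂ)
    (hdisc : ∀ (h h₃ : (adelicGroupData F E c 2 J).Adelic → ℂ), h ∈ holCotForms₂ F E c J hc hfix w₁ 𝔣 → h₃ ∈ holCotForms₂ F E c J hc hfix w₁ 𝔣 →
      ∀ (hhm : MemLp (toQuotFun (adelicGroupData F E c 2 J) h) 2 μ) (hh₃m : MemLp (toQuotFun (adelicGroupData F E c 2 J) h₃) 2 μ)
        (u : archLocal E 2 J w₁),
        ⟪(adelicGroupData F E c 2 J).rightRegular μ (adelicSingle F E c 2 J hc hfix w₁ u) (hhm.toLp (toQuotFun (adelicGroupData F E c 2 J) h)),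
          hh₃m.toLp (toQuotFun (adelicGroupData F E c 2 J) h₃)⟫_ℂ =
        m u * ⟪hhm.toLp (toQuotFun (adelicGroupData F E c 2 J) h), hh₃m.toLp (toQuotFun (adelicGroupData F E c 2 J) h₃)⟫_ℂ)
    {W : Type} [AddCommGroup W] [Module ℂ W] (σ : Representation ℂ (finAdelic F E c 2 J) W)
    (ψ : W →ₗ[ℂ] ((adelicGroupData F E c 2 J).Adelic → ℂ)) (hV : ∀ w, ψ w ∈ holCotForms₂ F E c J hc hfix w₁ 𝔣)
    (Λ : W →ₗ[ℂ] (adelicGroupData F E c 2 J).L2 μ)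
    (hΛ : ∀ (w : W) (h : MemLp (toQuotFun (adelicGroupData F E c 2 J) (ψ w)) 2 μ), Λ w = h.toLp (toQuotFun (adelicGroupData F E c 2 J) (ψ w)))
    (hΛe : ∀ (g : finAdelic F E c 2 J) (w : W), Λ (σ g w) = (adelicGroupData F E c 2 J).rightRegular μ (finAdelicToAdelic F E c 2 J g) (Λ w))
    (u : archLocal E 2 J w₁) {k : (adelicGroupData F E c 2 J).Adelic}
    (hk : k ∈ ((archAt F E c 2 J w₁ (hfix w₁.1) hc).ker).map (archToAdelic F E c 2 J)) (g : finAdelic F E c 2 J) (w w' : W) :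
    ⟪(adelicGroupData F E c 2 J).rightRegular μ (adelicSingle F E c 2 J hc hfix w₁ u * k * finAdelicToAdelic F E c 2 J g) (Λ w), Λ w'⟫_ℂ =
      m u * ⟪Λ (σ g w), Λ w'⟫_ℂ := by
  have hm1 : MemLp (toQuotFun (adelicGroupData F E c 2 J) (ψ (σ g w))) 2 μ := memLp_toQuotFun_self (hV (σ g w))
  have hm2 : MemLp (toQuotFun (adelicGroupData F E c 2 J) (ψ w')) 2 μ := memLp_toQuotFun_self (hV w')
  rw [map_mul, map_mul, ContinuousLinearMap.mul_def, ContinuousLinearMap.mul_def, ContinuousLinearMap.comp_apply,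
    ContinuousLinearMap.comp_apply, ← hΛe, hΛ (σ g w) hm1, toLp_eq_of_mem_Kc (hV (σ g w)) hm1 hk, hΛ w' hm2]
  exact hdisc _ _ (hV (σ g w)) (hV w') hm1 hm2 u

/-- **Non-vanishing of classes**: an equivariant `ψ ≠ 0` with cone-holomorphic values out of an IRREDUCIBLE `σ` is injective, so `Λ w ≠ 0` for every
`w ≠ 0` (continuity ★ `continuous_of_mem_holCotForms₂`, ★ `toLp_toQuotFun_ne_zero`). [cite: BorelJacquet1979, §4.6] [cite: BernsteinZelevinsky1976, §2.1] -/
theorem clsMap_ne_zero {W : Type} [AddCommGroup W] [Module ℂ W] (σ : Representation ℂ (finAdelic F E c 2 J) W) (hirr : σ.IsIrreducible)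
    (ψ : W →ₗ[ℂ] ((adelicGroupData F E c 2 J).Adelic → ℂ))
    (hE : ∀ (k : finAdelic F E c 2 J) (w : W), ψ (σ k w) = rightRep₂ F E c J k (ψ w))
    (hV : ∀ w, ψ w ∈ holCotForms₂ F E c J hc hfix w₁ 𝔣) (hne : ψ ≠ 0)
    (Λ : W →ₗ[ℂ] (adelicGroupData F E c 2 J).L2 μ)
    (hΛ : ∀ (w : W) (h : MemLp (toQuotFun (adelicGroupData F E c 2 J) (ψ w)) 2 μ), Λ w = h.toLp (toQuotFun (adelicGroupData F E c 2 J) (ψ w)))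
    {w : W} (hw : w ≠ 0) : Λ w ≠ 0 := by
  haveI := hirr
  -- `ψ` is injective: its kernel is a subrepresentation of the irreducible `σ`, and `ψ ≠ 0`
  have hψinj : Function.Injective ψ := by
    let N : Subrepresentation σ :=
      { toSubmodule := LinearMap.ker ψ
        apply_mem_toSubmodule := fun g w hw => by
          rw [LinearMap.mem_ker] at hw ⊢
          rw [hE, hw, map_zero] }
    rcases IsSimpleOrder.eq_bot_or_eq_top N with hN | hN
    · rw [← LinearMap.ker_eq_bot]
      exact congrArg Subrepresentation.toSubmodule hN
    · exact absurd (LinearMap.ker_eq_top.1 (congrArg Subrepresentation.toSubmodule hN)) hne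
  have hψw : ψ w ≠ 0 := fun h => hw (hψinj (by rw [h, map_zero]))
  rw [hΛ w (memLp_toQuotFun_self (hV w))]
  exact toLp_toQuotFun_ne_zero (leftInvariant_of_mem_holCotForms₂ (hV w)) (continuous_of_mem_holCotForms₂ F E c J hc hfix w₁ 𝔣 (hV w)) _ hψw

/-! ## §2 Schur scaling through `L² ⊕₂ L²` -/

omit [CompactSpace (adelicGroupData F E c 2 J).automorphicQuotient] in
/-- **SCHUR SCALING OF THE TWO GRAM FORMS.**  For `σ` irreducible admissible on `W` and two `σ`-EQUIVARIANT linear maps `Λ, Λ′ : W → L²`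
(`Λ (σ g w) = R(1,g) Λ w`, `R` unitary) with `Λ w₀ ≠ 0`: the Gram forms are proportional, `‖Λ w₀‖² · ⟪Λ′ w, Λ′ w′⟫ = ‖Λ′ w₀‖² · ⟪Λ w, Λ w′⟫`.
Schur for invariant sesquilinear forms (★ `F0P2aStubS1SesqSchur.stubS1_holds`) on `V := L² ⊕₂ L²`, `φ₁ = (Λ, Λ′)`, `φ₂ = (0, Λ′)`:
`⟪Λ′ w, Λ′ w′⟫ = c (⟪Λ w, Λ w′⟫ + ⟪Λ′ w, Λ′ w′⟫)`, and `c` is read off at `(w₀, w₀)`. [cite: Bump1997, Proposition 4.2.4] [cite: BernsteinZelevinsky1976, §2] -/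
theorem gram_eq_mul_gram {W : Type} [AddCommGroup W] [Module ℂ W] (σ : Representation ℂ (finAdelic F E c 2 J) W)
    (hirr : σ.IsIrreducible) (hadm : σ.IsAdmissible) (Λ Λ' : W →ₗ[ℂ] (adelicGroupData F E c 2 J).L2 μ)
    (hΛe : ∀ (g : finAdelic F E c 2 J) (w : W), Λ (σ g w) = (adelicGroupData F E c 2 J).rightRegular μ (finAdelicToAdelic F E c 2 J g) (Λ w))
    (hΛ'e : ∀ (g : finAdelic F E c 2 J) (w : W), Λ' (σ g w) = (adelicGroupData F E c 2 J).rightRegular μ (finAdelicToAdelic F E c 2 J g) (Λ' w))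
    (w₀ : W) (w w' : W) :
    ((‖Λ w₀‖ ^ 2 : ℝ) : ℂ) * ⟪Λ' w, Λ' w'⟫_ℂ = ((‖Λ' w₀‖ ^ 2 : ℝ) : ℂ) * ⟪Λ w, Λ w'⟫_ℂ := by
  -- the two maps into `V := L² ⊕₂ L²`
  set V := WithLp 2 ((adelicGroupData F E c 2 J).L2 μ × (adelicGroupData F E c 2 J).L2 μ) with hV
  set φ₁ : W →ₗ[ℂ] V := (WithLp.linearEquiv 2 ℂ ((adelicGroupData F E c 2 J).L2 μ × (adelicGroupData F E c 2 J).L2 μ)).symm.toLinearMap ∘ₗ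
    Λ.prod Λ' with hφ₁
  set φ₂ : W →ₗ[ℂ] V := (WithLp.linearEquiv 2 ℂ ((adelicGroupData F E c 2 J).L2 μ × (adelicGroupData F E c 2 J).L2 μ)).symm.toLinearMap ∘ₗ
    (0 : W →ₗ[ℂ] (adelicGroupData F E c 2 J).L2 μ).prod Λ' with hφ₂
  have h11 : ∀ w w' : W, ⟪φ₁ w, φ₁ w'⟫_ℂ = ⟪Λ w, Λ w'⟫_ℂ + ⟪Λ' w, Λ' w'⟫_ℂ := fun w w' => rfl
  have h12 : ∀ w w' : W, ⟪φ₁ w, φ₂ w'⟫_ℂ = ⟪Λ' w, Λ' w'⟫_ℂ := fun w w' => by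
    show ⟪Λ w, (0 : W →ₗ[ℂ] (adelicGroupData F E c 2 J).L2 μ) w'⟫_ℂ + ⟪Λ' w, Λ' w'⟫_ℂ = _
    rw [LinearMap.zero_apply, inner_zero_right, zero_add]
  -- invariance of both forms (`R` is unitary)
  have hb₁ : ∀ (g : finAdelic F E c 2 J) (w w' : W), ⟪φ₁ (σ g w), φ₁ (σ g w')⟫_ℂ = ⟪φ₁ w, φ₁ w'⟫_ℂ := by
    intro g w w'
    rw [h11, h11, hΛe, hΛe, hΛ'e, hΛ'e, inner_rightRegular_rightRegular, inner_rightRegular_rightRegular]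
  have hb₂ : ∀ (g : finAdelic F E c 2 J) (w w' : W), ⟪φ₁ (σ g w), φ₂ (σ g w')⟫_ℂ = ⟪φ₁ w, φ₂ w'⟫_ℂ := by
    intro g w w'
    rw [h12, h12, hΛ'e, hΛ'e, inner_rightRegular_rightRegular]
  -- a compact open subgroup of `U(J)(𝔸_f)`: the integral congruence level
  have hK : ∃ K₀ : OpenSubgroup (finAdelic F E c 2 J), IsCompact (K₀ : Set (finAdelic F E c 2 J)) :=
    ⟨⟨finCongruenceLevel F E c 2 J ⊤, (isCompact_isOpen_finCongruenceLevel_top F E c 2 J).2⟩,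
      (isCompact_isOpen_finCongruenceLevel_top F E c 2 J).1⟩
  -- Schur
  obtain ⟨c₀, hc₀⟩ := F0P2aStubS1SesqSchur.stubS1_holds (finAdelic F E c 2 J) W σ hirr hadm hK V φ₁ φ₂ hb₁ hb₂
  have hgen : ∀ w w' : W, ⟪Λ' w, Λ' w'⟫_ℂ = c₀ * (⟪Λ w, Λ w'⟫_ℂ + ⟪Λ' w, Λ' w'⟫_ℂ) := fun w w' => by
    have h := hc₀ w w'
    rw [h12, h11] at h
    exact h
  have h00 := hgen w₀ w₀
  rw [inner_self_eq_norm_sq_to_K, inner_self_eq_norm_sq_to_K] at h00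
  have hww := hgen w w'
  -- eliminate `c₀`
  have key : ((‖Λ w₀‖ : ℂ) ^ 2) * ⟪Λ' w, Λ' w'⟫_ℂ = ((‖Λ' w₀‖ : ℂ) ^ 2) * ⟪Λ w, Λ w'⟫_ℂ := by
    linear_combination (((‖Λ w₀‖ : ℂ) ^ 2) + ((‖Λ' w₀‖ : ℂ) ^ 2)) * hww - (⟪Λ w, Λ w'⟫_ℂ + ⟪Λ' w, Λ' w'⟫_ℂ) * h00
  simpa only [Complex.ofReal_pow] using key

end Summit.HodgeConjecture.HodgeConjecture.Cruxes.HLiu418.E1pGram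

end
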